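import Summits.Ventures.DiscreteObjects.PP12.PrimeList
import Summits.Ventures.DiscreteObjects.PP12.SquareLinearSpace

/-!
# Fixed-incidence counting for a collineation: flags, point pairs, line pairs (support file for `OrderFive`)
Framing: lottery ticket; floor = certified bounds/negative ranges.

For a collineation `σ` of a finite projective plane, the 'fixed incidence' relation `memF` (a fixed point on a fixed
line) and the three double counts used by `OrderFive.lean` (cell pub-namedobj, target M): fixed flags
(`fixed_flag_count`), pairs of fixed lines through a fixed point (`fixed_line_pair_count`: two distinct fixed lines
meet in exactly one point, which is fixed) and pairs of fixed points on a fixed line (`fixed_point_pair_count`), all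
obtained from the general identities of `SquareLinearSpace.lean`; plus the bookkeeping lemma `sum_three_eight`.
-/

namespace Summit.Ventures.DiscreteObjects.PP12

open Configuration Finset
open scoped Classical

namespace Collineation

variable {P L : Type*} [Membership P L] [ProjectivePlane P L] [Fintype P] [Fintype L]
  [DecidableEq P] [DecidableEq L] (σ : Collineation P L)

/-- the 'fixed incidence' relation: a fixed point on a fixed line -/
def memF (p : P) (m : L) : Prop := p ∈ m ∧ σ.onPoints p = p ∧ σ.onLines m = m

omit [ProjectivePlane P L] [Fintype P] in
/-- fixed-incidence line count = `fixedThrough` at fixed points, `0` elsewhere -/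
theorem lineCount_memF (p : P) :
    PP12.lineCount σ.memF p = if σ.onPoints p = p then σ.fixedThrough p else 0 := by
  classical
  unfold PP12.lineCount fixedThrough memF
  split_ifs with h
  · congr 1; ext m; simp [h]
  · rw [Finset.card_eq_zero]; ext m; simp [h]

omit [ProjectivePlane P L] [Fintype L] in
/-- fixed-incidence point count = `fixedOnLine` at fixed lines, `0` elsewhere -/
theorem pointCount_memF (m : L) :
    PP12.pointCount σ.memF m = if σ.onLines m = m then σ.fixedOnLine m else 0 := by
  classical
  unfold PP12.pointCount fixedOnLine memF
  split_ifs with h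
  · congr 1; ext p; simp [h]
  · rw [Finset.card_eq_zero]; ext p; simp [h]

omit [Fintype L] [DecidableEq P] in
/-- two distinct fixed lines meet in exactly one fixed point; otherwise the fixed meet count is 0 -/
theorem meetCount_memF {m₁ m₂ : L} (hne : m₁ ≠ m₂) :
    PP12.meetCount σ.memF m₁ m₂ = if σ.onLines m₁ = m₁ ∧ σ.onLines m₂ = m₂ then 1 else 0 := by
  classical
  unfold PP12.meetCount memF
  split_ifs with h
  · rw [Finset.card_eq_one]
    refine ⟨HasPoints.mkPoint hne, ?_⟩
    have hx := HasPoints.mkPoint_ax (P := P) hne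
    ext p
    simp only [mem_filter, mem_univ, true_and, mem_singleton]
    constructor
    · rintro ⟨⟨h1, -, -⟩, h2, -, -⟩
      exact (Nondegenerate.eq_or_eq h1 hx.1 h2 hx.2).resolve_right hne
    · rintro rfl
      have fx := σ.point_fixed_of_two_fixed hx.1 hx.2 hne h.1 h.2
      exact ⟨⟨hx.1, fx, h.1⟩, hx.2, fx, h.2⟩
  · rw [Finset.card_eq_zero]; ext p
    simp only [mem_filter, mem_univ, true_and, Finset.notMem_empty, iff_false]
    rintro ⟨⟨-, -, h1⟩, -, -, h2⟩
    exact h ⟨h1, h2⟩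

omit [Fintype P] [DecidableEq L] in
/-- two distinct fixed points lie on exactly one fixed line; otherwise the fixed join count is 0 -/
theorem joinCount_memF {p₁ p₂ : P} (hne : p₁ ≠ p₂) :
    PP12.joinCount σ.memF p₁ p₂ = if σ.onPoints p₁ = p₁ ∧ σ.onPoints p₂ = p₂ then 1 else 0 := by
  classical
  unfold PP12.joinCount memF
  split_ifs with h
  · rw [Finset.card_eq_one]
    refine ⟨HasLines.mkLine hne, ?_⟩
    have hx := HasLines.mkLine_ax (L := L) hne
    ext m
    simp only [mem_filter, mem_univ, true_and, mem_singleton]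
    constructor
    · rintro ⟨⟨h1, -, -⟩, h2, -, -⟩
      exact (Nondegenerate.eq_or_eq h1 h2 hx.1 hx.2).resolve_left hne
    · rintro rfl
      have fm := σ.line_fixed_of_two_fixed hx.1 hx.2 hne h.1 h.2
      exact ⟨⟨hx.1, h.1, fm⟩, hx.2, h.2, fm⟩
  · rw [Finset.card_eq_zero]; ext m
    simp only [mem_filter, mem_univ, true_and, Finset.notMem_empty, iff_false]
    rintro ⟨⟨-, h1, -⟩, -, h2, -⟩
    exact h ⟨h1, h2⟩

/-- A sum of values in `{3, 8}` over a finset. -/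
theorem sum_three_eight {α : Type*} (s : Finset α) (g : α → ℕ)
    (h : ∀ x ∈ s, g x = 3 ∨ g x = 8) :
    ∑ x ∈ s, g x = 8 * (s.filter fun x => g x = 8).card + 3 * (s.filter fun x => ¬ g x = 8).card ∧
    ∑ x ∈ s, g x ^ 2 = 64 * (s.filter fun x => g x = 8).card + 9 * (s.filter fun x => ¬ g x = 8).card ∧
    (s.filter fun x => g x = 8).card + (s.filter fun x => ¬ g x = 8).card = s.card := by
  have h3 : ∀ x ∈ s.filter (fun x => ¬ g x = 8), g x = 3 := fun x hx =>
    (h x (Finset.mem_filter.mp hx).1).resolve_right (Finset.mem_filter.mp hx).2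
  have h8 : ∀ x ∈ s.filter (fun x => g x = 8), g x = 8 := fun x hx => (Finset.mem_filter.mp hx).2
  refine ⟨?_, ?_, Finset.card_filter_add_card_filter_not _⟩
  · rw [← Finset.sum_filter_add_sum_filter_not s (fun x => g x = 8),
      Finset.sum_const_nat h8, Finset.sum_const_nat h3]
    ring
  · rw [← Finset.sum_filter_add_sum_filter_not s (fun x => g x = 8),
      Finset.sum_const_nat (m := 64) (fun x hx => by rw [h8 x hx]; norm_num),
      Finset.sum_const_nat (m := 9) (fun x hx => by rw [h3 x hx]; norm_num)]
    ring

omit [ProjectivePlane P L] in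
/-- Fixed flags counted by points and by lines. -/
theorem fixed_flag_count :
    ∑ p ∈ univ.filter (fun x : P => σ.onPoints x = x), σ.fixedThrough p
      = ∑ m ∈ univ.filter (fun m : L => σ.onLines m = m), σ.fixedOnLine m := by
  have h := sum_lineCount_eq_sum_pointCount σ.memF
  simp only [lineCount_memF, pointCount_memF] at h
  rw [← Finset.sum_filter, ← Finset.sum_filter] at h
  exact h

/-- Pairs of fixed lines through a fixed point: `Σ_fixed p t_p² = Σ_fixed m k_m + L(L−1)`. -/
theorem fixed_line_pair_count :
    ∑ p ∈ univ.filter (fun x : P => σ.onPoints x = x), σ.fixedThrough p ^ 2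
      = ∑ m ∈ univ.filter (fun m : L => σ.onLines m = m), σ.fixedOnLine m
        + (univ.filter (fun m : L => σ.onLines m = m)).card
          * ((univ.filter (fun m : L => σ.onLines m = m)).card - 1) := by
  set T : Finset L := univ.filter fun m => σ.onLines m = m with hT
  have h := sum_lineCount_sq σ.memF
  have hl : ∑ p, PP12.lineCount σ.memF p ^ 2
      = ∑ p ∈ univ.filter (fun x : P => σ.onPoints x = x), σ.fixedThrough p ^ 2 := by
    rw [← Finset.sum_filter_add_sum_filter_not univ (fun x : P => σ.onPoints x = x)]
    have e1 : ∑ p ∈ univ.filter (fun x : P => σ.onPoints x = x), PP12.lineCount σ.memF p ^ 2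
        = ∑ p ∈ univ.filter (fun x : P => σ.onPoints x = x), σ.fixedThrough p ^ 2 :=
      Finset.sum_congr rfl (fun p hp => by rw [lineCount_memF, if_pos (Finset.mem_filter.mp hp).2])
    have e2 : ∑ p ∈ univ.filter (fun x : P => ¬ σ.onPoints x = x), PP12.lineCount σ.memF p ^ 2 = 0 :=
      Finset.sum_eq_zero (fun p hp => by rw [lineCount_memF, if_neg (Finset.mem_filter.mp hp).2]; simp)
    rw [e1, e2, add_zero]
  have hr : ∀ m₁ : L, ∑ m₂, PP12.meetCount σ.memF m₁ m₂
      = (if σ.onLines m₁ = m₁ then σ.fixedOnLine m₁ + (T.card - 1) else 0) := by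
    intro m₁
    rw [← Finset.add_sum_erase univ _ (mem_univ m₁), meetCount_self, pointCount_memF]
    split_ifs with h1
    · congr 1
      rw [Finset.sum_congr rfl (fun m₂ hm₂ => by
        rw [σ.meetCount_memF (Finset.ne_of_mem_erase hm₂).symm, if_congr (and_iff_right h1) rfl rfl])]
      rw [Finset.sum_boole]
      simp only [Nat.cast_id]
      have : (univ.erase m₁).filter (fun m₂ : L => σ.onLines m₂ = m₂) = T.erase m₁ := by
        ext m; simp [hT, and_comm]
      rw [this, Finset.card_erase_of_mem (by simpa [hT] using h1)]
    · rw [Finset.sum_eq_zero (fun m₂ hm₂ => by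
        rw [σ.meetCount_memF (Finset.ne_of_mem_erase hm₂).symm, if_neg (fun h => h1 h.1)])]
      simp
  rw [hl] at h
  rw [h, Finset.sum_congr rfl (fun m₁ _ => hr m₁), ← Finset.sum_filter]
  change ∑ m ∈ T, (σ.fixedOnLine m + (T.card - 1)) = _
  rw [Finset.sum_add_distrib, Finset.sum_const, smul_eq_mul]

/-- Pairs of fixed points on a fixed line: `Σ_fixed m k_m² = Σ_fixed p t_p + f(f−1)`. -/
theorem fixed_point_pair_count :
    ∑ m ∈ univ.filter (fun m : L => σ.onLines m = m), σ.fixedOnLine m ^ 2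
      = ∑ p ∈ univ.filter (fun x : P => σ.onPoints x = x), σ.fixedThrough p
        + (univ.filter (fun x : P => σ.onPoints x = x)).card
          * ((univ.filter (fun x : P => σ.onPoints x = x)).card - 1) := by
  set S : Finset P := univ.filter fun x => σ.onPoints x = x with hS
  have h := sum_pointCount_sq σ.memF
  have hl : ∑ m, PP12.pointCount σ.memF m ^ 2
      = ∑ m ∈ univ.filter (fun m : L => σ.onLines m = m), σ.fixedOnLine m ^ 2 := by
    rw [← Finset.sum_filter_add_sum_filter_not univ (fun m : L => σ.onLines m = m)]
    have e1 : ∑ m ∈ univ.filter (fun m : L => σ.onLines m = m), PP12.pointCount σ.memF m ^ 2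
        = ∑ m ∈ univ.filter (fun m : L => σ.onLines m = m), σ.fixedOnLine m ^ 2 :=
      Finset.sum_congr rfl (fun m hm => by rw [pointCount_memF, if_pos (Finset.mem_filter.mp hm).2])
    have e2 : ∑ m ∈ univ.filter (fun m : L => ¬ σ.onLines m = m), PP12.pointCount σ.memF m ^ 2 = 0 :=
      Finset.sum_eq_zero (fun m hm => by rw [pointCount_memF, if_neg (Finset.mem_filter.mp hm).2]; simp)
    rw [e1, e2, add_zero]
  have hr : ∀ p₁ : P, ∑ p₂, PP12.joinCount σ.memF p₁ p₂
      = (if σ.onPoints p₁ = p₁ then σ.fixedThrough p₁ + (S.card - 1) else 0) := by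
    intro p₁
    rw [← Finset.add_sum_erase univ _ (mem_univ p₁), joinCount_self, lineCount_memF]
    split_ifs with h1
    · congr 1
      rw [Finset.sum_congr rfl (fun p₂ hp₂ => by
        rw [σ.joinCount_memF (Finset.ne_of_mem_erase hp₂).symm, if_congr (and_iff_right h1) rfl rfl])]
      rw [Finset.sum_boole]
      simp only [Nat.cast_id]
      have : (univ.erase p₁).filter (fun p₂ : P => σ.onPoints p₂ = p₂) = S.erase p₁ := by
        ext p; simp [hS, and_comm]
      rw [this, Finset.card_erase_of_mem (by simpa [hS] using h1)]
    · rw [Finset.sum_eq_zero (fun p₂ hp₂ => by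
        rw [σ.joinCount_memF (Finset.ne_of_mem_erase hp₂).symm, if_neg (fun h => h1 h.1)])]
      simp
  rw [hl] at h
  rw [h, Finset.sum_congr rfl (fun p₁ _ => hr p₁), ← Finset.sum_filter]
  change ∑ p ∈ S, (σ.fixedThrough p + (S.card - 1)) = _
  rw [Finset.sum_add_distrib, Finset.sum_const, smul_eq_mul]

end Collineation

end Summit.Ventures.DiscreteObjects.PP12
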